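import Mathlib
import HarnessLib
import Summits.NavierStokesRegularity.NavierStokesRegularity.Theorems.ThreadingFluxHorizonTowerDipoleTowerParity
import Summits.NavierStokesRegularity.NavierStokesRegularity.Theorems.ThreadingFluxHorizonTowerDipoleTowerDipole
import Summits.NavierStokesRegularity.NavierStokesRegularity.Theorems.ThreadingFluxHorizonTowerDipoleTowerPolynomial
import Summits.NavierStokesRegularity.NavierStokesRegularity.Theorems.ThreadingFluxHorizonTowerDipoleTowerRadial
import Summits.NavierStokesRegularity.NavierStokesRegularity.Theorems.ThreadingFluxHorizonTowerL2ClosedFormLaw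

/-!
# Crux `PoloidalLiouville` (stmt-NavierStokesRegularity-1222, wall W1), crux idea «horizon-threading-tower» (ns-idea-15):
# DIPOLE TOWERS `{1, m, n}` (`m, n` NOT BOTH ODD) ARE DECIDED AT ORDER ONE

ARM A (ns-exp-scalarLiouville g6), director KEY 2026-08-29T05:03:18Z («PROVE `DipoleTowerHorizonZonality`»; typed statement
`pub/ns-exp-scalarLiouville/STATEMENT-dipole-tower-order-one-ARM-A-g5.md`, critic ns-wall-crit-1 g4 05:01:51Z: NO STRIKE, size M, remarks
r1–r3).  Route ns-wall-eng-3 g3 (TwoShellTowers-RESULTS §4b) on the finite-tower toolkit p693759/p695631 and `ZonalUniqueness` p695724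
(imported, never restated), helpers 1–5 of ARM A (p696946 Parity, p697309 Dipole, p697436 Meridional, Polynomial, Radial).

THEOREM ★ `dipoleTowerHorizonZonality_of` (= the body of the Prop `HorizonTower.DipoleTowerHorizonZonality`, binder for binder): a scale-free
three-shell tower `U_A + U_B + U_C` of horizon profiles of non-zero solid harmonics `A ∈ 𝓗_1` (the dipole), `B ∈ 𝓗_m`, `C ∈ 𝓗_n`,
`2 ≤ m, n`, `m ≠ n`, `m, n` not both odd, annihilated by the order-one horizon law `𝔏₁` off the centre, is coaxially zonal.
PROOF.  The parity split of the order-one identity (helper 1) leaves one single-pair class — that pair is coaxial about an axis `a`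
(eng-3's mixed-degree rigidity) — and one two-term class.  Multiplying the two-term class by `|a × x|²` and a positive radial weight and
using `bracket_with_zonal` (toolkit) and `∇A ≡ κ a` (helper 2) turns it into `D·Q = 0` off the centre with POLYNOMIAL factors (helper 4):
* `m` even, `n = 2k+1` odd (`dipoleTower_zonal_of_even_odd`): `D = ⟪a × x, ∇B⟫`, `Q = −κ(λ₁−λ_m)(‖x‖²)^k|a × x|² + (λ_m−λ_n) M_C`;
  `Q ≡ 0` would make the meridional multiplier `M_C` of `C` equal to a dipole multiplier, excluded by the ODD ENGINE (helper 5); so `D ≡ 0`.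
* `m` odd, `n` even: the same with `(m, B) ↔ (n, C)` (`dipoleTower_zonal_of_odd_even`).
* both even (`dipoleTower_zonal_of_even_even`): `B`, `C` coaxial about `a`, `∇A ≡ b`; `D = ⟪x, b × a⟫`, `Q = (λ₁−λ_m)(‖x‖²)^{n/2} M_B +
  (λ₁−λ_n)(‖x‖²)^{m/2} M_C = M_W`, `W = (λ₁−λ_m)(‖x‖²)^{n/2} B + (λ₁−λ_n)(‖x‖²)^{m/2} C`; `Q ≡ 0` makes `W` rotation-invariant about
  every axis (helper 3), i.e. radial, `W = w (‖x‖²)^{(m+n)/2}`, excluded by the EVEN ENGINE (helper 5; the degree-`m ≥ 2` shell `B`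
  dies — critic r2); so `D ≡ 0`, i.e. `b ∥ a`.
The product dichotomy `D ≡ 0 ∨ Q ≡ 0` is helper 4's `evalE_mul_dichotomy` (integral domain `ℝ[X₀,X₁,X₂]`; critic r1).  The zonal
functional forms then come from `exists_zonalForm_of_inner_cross_gradient_eq_zero` (p-ZonalForm, eng-7).

HONEST LABEL / BOOKING: ★★ special-case theorem of the crux-IDEA conjecture `HorizonTowerZonality` (2) (three shells, one the dipole, a
parity side condition); `HorizonTowerZonality`, `PoloidalLiouville` (1222), W1 and NS regularity are OPEN / NOT proved and untouched
(W1 movement 0); nothing here is an NS statement.  `--supports stmt-NavierStokesRegularity-1222 --as helper`.  The by-name inhabitant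
of `DipoleTowerHorizonZonality` follows once that Prop is appended to the Defs twin.
-/

-- the summit and its single sub-problem share the name (CONVENTIONS §1)
set_option linter.dupNamespace false

noncomputable section

namespace Summit.NavierStokesRegularity.NavierStokesRegularity.Theorems.PoloidalLiouville.HorizonTower

open Set Function Filter Topology InnerProductSpace
open scoped RealInnerProductSpace
open Literature.Analysis.FluidPDE
open Literature.Geometry.DiscreteGeometry (inner_fin3 norm_sq_fin3)

section DipoleTowerOrderOne

variable {m n : ℕ} {A B C : E3 → ℝ}

/-! ### `m` even, `n` odd -/

/-- ★ `m` even, `n` odd: the whole dipole tower is zonal about ONE axis (rotational form).  The even class `{(1,n)}` makes `A`, `C` coaxial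
about `a` (helper 1); the odd class `T_{1m} + T_{mn} = 0`, multiplied by `|a × x|² (‖x‖²)^{(m+n)/2}`, reads `D·Q = 0` with
`D = ⟪a × x, ∇B⟫`; `Q ≡ 0` is excluded by the odd engine, so `D ≡ 0` by the product dichotomy. -/
theorem dipoleTower_zonal_of_even_odd (hm : 2 ≤ m) (hn : 2 ≤ n) (hmn : m ≠ n) (hme : Even m) (hno : Odd n)
    (hA : ContDiff ℝ (⊤ : ℕ∞) A) (hhomA : ∀ (c : ℝ) (y : E3), A (c • y) = c ^ 1 * A y) (hharmA : ∀ y, Laplacian.laplacian A y = 0)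
    (hB : ContDiff ℝ (⊤ : ℕ∞) B) (hhomB : ∀ (c : ℝ) (y : E3), B (c • y) = c ^ m * B y) (hharmB : ∀ y, Laplacian.laplacian B y = 0)
    (hC : ContDiff ℝ (⊤ : ℕ∞) C) (hhomC : ∀ (c : ℝ) (y : E3), C (c • y) = c ^ n * C y) (hharmC : ∀ y, Laplacian.laplacian C y = 0)
    (hA0 : ∃ y, A y ≠ 0) (hC0 : ∃ y, C y ≠ 0)
    (hL1 : ∀ x : E3, x ≠ 0 →
      horizonL1 (fun z => horizonProfile 1 A 0 z + horizonProfile m B 0 z + horizonProfile n C 0 z) 0 x = 0) :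
    ∃ a : E3, a ≠ 0 ∧ (∀ x : E3, ⟪cross a x, gradient A x⟫ = 0) ∧ (∀ x : E3, ⟪cross a x, gradient B x⟫ = 0) ∧
      (∀ x : E3, ⟪cross a x, gradient C x⟫ = 0) := by
  classical
  obtain ⟨a, ha, hAz, hCz⟩ :=
    dipoleTower_coaxial_AC_of_even_odd hm hn hmn hme hno hA hhomA hharmA hB hhomB hharmB hC hhomC hharmC hA0 hC0 hL1
  refine ⟨a, ha, hAz, ?_, hCz⟩
  -- the dipole: `∇A ≡ κ a`, `κ ≠ 0`
  have hAd : Differentiable ℝ A := hA.differentiable (by simp)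
  obtain ⟨κ, hκ⟩ := dipole_gradient_eq_smul_axis hAd hhomA ha hAz
  have hκ0 : κ ≠ 0 := by
    rintro rfl
    obtain ⟨y, hy⟩ := hA0
    apply hy
    rw [dipole_eq_fderiv_apply hAd hhomA y, ← inner_gradient_eq_fderiv, hκ 0, zero_smul, inner_zero_left]
  -- `n = 2k + 1`, `k ≥ 1`
  obtain ⟨k, hk⟩ := hno
  have hk1 : 1 ≤ k := by omega
  -- the weights
  have hc1m : ((1 * (1 + 1) : ℝ)) - (m * (m + 1) : ℝ) ≠ 0 := by
    have h := mul_succ_ne_of_ne (l := 1) (m := m) (by omega)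
    push_cast at h
    exact h
  have hcmn : ((m * (m + 1) : ℝ)) - (n * (n + 1) : ℝ) ≠ 0 := mul_succ_ne_of_ne (l := m) (m := n) hmn
  -- `B`, `C` are polynomial functions
  obtain ⟨p, -, hBp⟩ := Zonal.exists_mvPolynomial_of_homogeneous hB hhomB
  obtain ⟨q, -, hCq⟩ := Zonal.exists_mvPolynomial_of_homogeneous hC hhomC
  have hBfun : B = Zonal.evalE p := funext hBp
  have hCfun : C = Zonal.evalE q := funext hCq
  -- the two factors `D`, `Q`
  have hDpoly : ∃ d : MvPolynomial (Fin 3) ℝ, ∀ x : E3, ⟪cross a x, gradient B x⟫ = Zonal.evalE d x := by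
    rw [hBfun]; exact exists_evalE_rot a p
  have hQpoly : ∃ d : MvPolynomial (Fin 3) ℝ, ∀ x : E3,
      (-(κ * (((1 * (1 + 1) : ℝ)) - (m * (m + 1) : ℝ)))) * ((‖x‖ ^ 2) ^ k * ‖cross a x‖ ^ 2)
        + ((((m * (m + 1) : ℝ)) - (n * (n + 1) : ℝ))) * (‖x‖ ^ 2 * ⟪gradient C x, a⟫ - ⟪a, x⟫ * ⟪gradient C x, x⟫)
        = Zonal.evalE d x := by
    rw [hCfun]
    exact exists_evalE_linComb (exists_evalE_normSq_pow_mul_crossNormSq a k) (exists_evalE_meridional a q) _ _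
  -- the two-term class identity `D·Q = 0` off the centre
  have hDQ : ∀ x : E3, x ≠ 0 →
      ⟪cross a x, gradient B x⟫ *
        ((-(κ * (((1 * (1 + 1) : ℝ)) - (m * (m + 1) : ℝ)))) * ((‖x‖ ^ 2) ^ k * ‖cross a x‖ ^ 2)
          + ((((m * (m + 1) : ℝ)) - (n * (n + 1) : ℝ))) * (‖x‖ ^ 2 * ⟪gradient C x, a⟫ - ⟪a, x⟫ * ⟪gradient C x, x⟫)) = 0 := by
    intro x hx
    have h := (dipoleTower_pair_identities hm hn hmn hA hhomA hharmA hB hhomB hharmB hC hhomC hharmC hL1 hx).2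
    have h1m : ¬ Even (1 + m) := by rw [add_comm, Nat.even_add_one, not_not]; exact hme
    have h1n : Even (1 + n) := by rw [add_comm, hk]; exact (odd_two_mul_add_one k).add_one
    have hmn' : ¬ Even (m + n) := by
      rw [Nat.even_add]; exact fun h' => (Nat.not_even_iff_odd.2 ⟨k, hk⟩) (h'.1 hme)
    rw [if_neg h1m, if_pos h1n, if_neg hmn', add_zero] at h
    have hρ : 0 < ‖x‖ ^ 2 := by positivity
    -- the brackets through `D = ⟪a × x, ∇B⟫`
    have hAB : ⟪x, cross (gradient A x) (gradient B x)⟫ = -κ * ⟪cross a x, gradient B x⟫ := by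
      rw [hκ x]; exact inner_cross_smul_left_eq κ a x _
    have hBC : ‖cross a x‖ ^ 2 * ⟪x, cross (gradient B x) (gradient C x)⟫
        = (‖x‖ ^ 2 * ⟪gradient C x, a⟫ - ⟪a, x⟫ * ⟪gradient C x, x⟫) * ⟪cross a x, gradient B x⟫ := by
      rw [bracket_with_zonal (hCz x), inner_cross_right_eq]
    -- the radial weights
    have e1 : (‖x‖ ^ 2) ^ (-(1 : ℝ) / 2) * (‖x‖ ^ 2) ^ (-(m : ℝ) / 2) * ((‖x‖ ^ 2) ^ ((m : ℝ) / 2) * (‖x‖ ^ 2) ^ ((n : ℝ) / 2))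
        = (‖x‖ ^ 2) ^ k := by
      rw [← Real.rpow_add hρ, ← Real.rpow_add hρ, ← Real.rpow_add hρ, ← Real.rpow_natCast _ k]
      congr 1
      rw [hk]; push_cast; ring
    have e2 : (‖x‖ ^ 2) ^ (-(m : ℝ) / 2) * (‖x‖ ^ 2) ^ (-(n : ℝ) / 2) * ((‖x‖ ^ 2) ^ ((m : ℝ) / 2) * (‖x‖ ^ 2) ^ ((n : ℝ) / 2))
        = 1 := by
      rw [← Real.rpow_add hρ, ← Real.rpow_add hρ, ← Real.rpow_add hρ]
      rw [show -(m : ℝ) / 2 + -(n : ℝ) / 2 + ((m : ℝ) / 2 + (n : ℝ) / 2) = 0 by ring, Real.rpow_zero]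
    linear_combination
      (‖cross a x‖ ^ 2 * ((‖x‖ ^ 2) ^ ((m : ℝ) / 2) * (‖x‖ ^ 2) ^ ((n : ℝ) / 2))) * h
      - ((((1 * (1 + 1) : ℝ)) - (m * (m + 1) : ℝ)) * ‖cross a x‖ ^ 2 * ⟪x, cross (gradient A x) (gradient B x)⟫) * e1
      - ((((m * (m + 1) : ℝ)) - (n * (n + 1) : ℝ)) * ‖cross a x‖ ^ 2 * ⟪x, cross (gradient B x) (gradient C x)⟫) * e2
      - ((((1 * (1 + 1) : ℝ)) - (m * (m + 1) : ℝ)) * ‖cross a x‖ ^ 2 * (‖x‖ ^ 2) ^ k) * hAB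
      - ((((m * (m + 1) : ℝ)) - (n * (n + 1) : ℝ))) * hBC
  -- the dichotomy
  rcases evalE_mul_dichotomy hDpoly hQpoly hDQ with hD0 | hQ0
  · exact hD0
  · -- `Q ≡ 0`: the meridional multiplier of `C` is a dipole multiplier — impossible for `C ≠ 0`
    exfalso
    have hM : ∀ x : E3, ‖x‖ ^ 2 * ⟪gradient C x, a⟫ - ⟪a, x⟫ * ⟪gradient C x, x⟫
        = (κ * (((1 * (1 + 1) : ℝ)) - (m * (m + 1) : ℝ)) / (((m * (m + 1) : ℝ)) - (n * (n + 1) : ℝ)))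
          * ((‖x‖ ^ 2) ^ k * ‖cross a x‖ ^ 2) := by
      intro x
      have h := hQ0 x
      rw [div_mul_eq_mul_div, eq_div_iff hcmn]
      linear_combination h
    obtain ⟨y, hy⟩ := hC0
    exact hy (eq_zero_of_meridional_eq_dipoleMultiplier ha hk hk1 hC hhomC hharmC hCz hM y)

/-! ### `m` odd, `n` even -/

/-- ★ `m` odd, `n` even: the whole dipole tower is zonal about ONE axis — the previous case with `(m, B) ↔ (n, C)`. -/
theorem dipoleTower_zonal_of_odd_even (hm : 2 ≤ m) (hn : 2 ≤ n) (hmn : m ≠ n) (hmo : Odd m) (hne : Even n)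
    (hA : ContDiff ℝ (⊤ : ℕ∞) A) (hhomA : ∀ (c : ℝ) (y : E3), A (c • y) = c ^ 1 * A y) (hharmA : ∀ y, Laplacian.laplacian A y = 0)
    (hB : ContDiff ℝ (⊤ : ℕ∞) B) (hhomB : ∀ (c : ℝ) (y : E3), B (c • y) = c ^ m * B y) (hharmB : ∀ y, Laplacian.laplacian B y = 0)
    (hC : ContDiff ℝ (⊤ : ℕ∞) C) (hhomC : ∀ (c : ℝ) (y : E3), C (c • y) = c ^ n * C y) (hharmC : ∀ y, Laplacian.laplacian C y = 0)
    (hA0 : ∃ y, A y ≠ 0) (hB0 : ∃ y, B y ≠ 0)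
    (hL1 : ∀ x : E3, x ≠ 0 →
      horizonL1 (fun z => horizonProfile 1 A 0 z + horizonProfile m B 0 z + horizonProfile n C 0 z) 0 x = 0) :
    ∃ a : E3, a ≠ 0 ∧ (∀ x : E3, ⟪cross a x, gradient A x⟫ = 0) ∧ (∀ x : E3, ⟪cross a x, gradient B x⟫ = 0) ∧
      (∀ x : E3, ⟪cross a x, gradient C x⟫ = 0) := by
  have hL1' : ∀ x : E3, x ≠ 0 →
      horizonL1 (fun z => horizonProfile 1 A 0 z + horizonProfile n C 0 z + horizonProfile m B 0 z) 0 x = 0 := by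
    have hfun : (fun z => horizonProfile 1 A 0 z + horizonProfile n C 0 z + horizonProfile m B 0 z)
        = fun z => horizonProfile 1 A 0 z + horizonProfile m B 0 z + horizonProfile n C 0 z :=
      funext fun z => add_right_comm _ _ _
    rw [hfun]; exact hL1
  obtain ⟨a, ha, hAz, hCz, hBz⟩ :=
    dipoleTower_zonal_of_even_odd hn hm hmn.symm hne hmo hA hhomA hharmA hC hhomC hharmC hB hhomB hharmB hA0 hB0 hL1'
  exact ⟨a, ha, hAz, hBz, hCz⟩

/-! ### `m`, `n` both even -/

/-- ★ `m`, `n` both even: the whole dipole tower is zonal about ONE axis (rotational form).  The even class `{(m,n)}` makes `B`, `C`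
coaxial about `a` (helper 1); with `∇A ≡ b` the odd class `T_{1m} + T_{1n} = 0`, multiplied by `|a × x|² (‖x‖²)^{(1+m+n)/2}`, reads
`⟪x, b × a⟫ · M_W(x) = 0`, `W = (λ₁−λ_m)(‖x‖²)^{n/2} B + (λ₁−λ_n)(‖x‖²)^{m/2} C`; `M_W ≡ 0` would make `W` radial (helper 3), which the
even engine excludes (the shell `B` of degree `m ≥ 2` is non-zero); so `⟪x, b × a⟫ ≡ 0`, i.e. `A` is zonal about `a` too. -/
theorem dipoleTower_zonal_of_even_even (hm : 2 ≤ m) (hn : 2 ≤ n) (hmn : m ≠ n) (hme : Even m) (hne : Even n)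
    (hA : ContDiff ℝ (⊤ : ℕ∞) A) (hhomA : ∀ (c : ℝ) (y : E3), A (c • y) = c ^ 1 * A y) (hharmA : ∀ y, Laplacian.laplacian A y = 0)
    (hB : ContDiff ℝ (⊤ : ℕ∞) B) (hhomB : ∀ (c : ℝ) (y : E3), B (c • y) = c ^ m * B y) (hharmB : ∀ y, Laplacian.laplacian B y = 0)
    (hC : ContDiff ℝ (⊤ : ℕ∞) C) (hhomC : ∀ (c : ℝ) (y : E3), C (c • y) = c ^ n * C y) (hharmC : ∀ y, Laplacian.laplacian C y = 0)
    (hB0 : ∃ y, B y ≠ 0) (hC0 : ∃ y, C y ≠ 0)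
    (hL1 : ∀ x : E3, x ≠ 0 →
      horizonL1 (fun z => horizonProfile 1 A 0 z + horizonProfile m B 0 z + horizonProfile n C 0 z) 0 x = 0) :
    ∃ a : E3, a ≠ 0 ∧ (∀ x : E3, ⟪cross a x, gradient A x⟫ = 0) ∧ (∀ x : E3, ⟪cross a x, gradient B x⟫ = 0) ∧
      (∀ x : E3, ⟪cross a x, gradient C x⟫ = 0) := by
  classical
  obtain ⟨a, ha, hBz, hCz⟩ :=
    dipoleTower_coaxial_BC_of_even_even hm hn hmn hme hne hA hhomA hharmA hB hhomB hharmB hC hhomC hharmC hB0 hC0 hL1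
  refine ⟨a, ha, ?_, hBz, hCz⟩
  -- the dipole: `∇A ≡ b`
  have hAd : Differentiable ℝ A := hA.differentiable (by simp)
  have hBd : Differentiable ℝ B := hB.differentiable (by simp)
  have hCd : Differentiable ℝ C := hC.differentiable (by simp)
  set b : E3 := gradient A 0 with hb
  have hgA : ∀ x : E3, gradient A x = b := fun x => dipole_gradient_eq hAd hhomA x
  -- `m = 2m'`, `n = 2n'`
  obtain ⟨m', hm'⟩ := hme
  obtain ⟨n', hn'⟩ := hne
  have hm'1 : 1 ≤ m' := by omega
  -- the weights
  have hc1m : ((1 * (1 + 1) : ℝ)) - (m * (m + 1) : ℝ) ≠ 0 := by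
    have h := mul_succ_ne_of_ne (l := 1) (m := m) (by omega)
    push_cast at h
    exact h
  have hc1n : ((1 * (1 + 1) : ℝ)) - (n * (n + 1) : ℝ) ≠ 0 := by
    have h := mul_succ_ne_of_ne (l := 1) (m := n) (by omega)
    push_cast at h
    exact h
  -- `B`, `C` are polynomial functions
  obtain ⟨p, -, hBp⟩ := Zonal.exists_mvPolynomial_of_homogeneous hB hhomB
  obtain ⟨q, -, hCq⟩ := Zonal.exists_mvPolynomial_of_homogeneous hC hhomC
  have hBfun : B = Zonal.evalE p := funext hBp
  have hCfun : C = Zonal.evalE q := funext hCq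
  -- the two factors `D = ⟪x, b × a⟫`, `Q = M_W`
  have hDpoly : ∃ d : MvPolynomial (Fin 3) ℝ, ∀ x : E3, ⟪x, cross b a⟫ = Zonal.evalE d x := exists_evalE_inner_cross_const b a
  have hQpoly : ∃ d : MvPolynomial (Fin 3) ℝ, ∀ x : E3,
      (((1 * (1 + 1) : ℝ)) - (m * (m + 1) : ℝ)) * ((‖x‖ ^ 2) ^ n' * (‖x‖ ^ 2 * ⟪gradient B x, a⟫ - ⟪a, x⟫ * ⟪gradient B x, x⟫))
        + (((1 * (1 + 1) : ℝ)) - (n * (n + 1) : ℝ)) * ((‖x‖ ^ 2) ^ m' * (‖x‖ ^ 2 * ⟪gradient C x, a⟫ - ⟪a, x⟫ * ⟪gradient C x, x⟫))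
        = Zonal.evalE d x := by
    rw [hBfun, hCfun]
    exact exists_evalE_linComb (exists_evalE_normSq_pow_mul (exists_evalE_meridional a p) n')
      (exists_evalE_normSq_pow_mul (exists_evalE_meridional a q) m') _ _
  -- the two-term class identity `D·Q = 0` off the centre
  have hDQ : ∀ x : E3, x ≠ 0 →
      ⟪x, cross b a⟫ *
        ((((1 * (1 + 1) : ℝ)) - (m * (m + 1) : ℝ)) * ((‖x‖ ^ 2) ^ n' * (‖x‖ ^ 2 * ⟪gradient B x, a⟫ - ⟪a, x⟫ * ⟪gradient B x, x⟫))
          + (((1 * (1 + 1) : ℝ)) - (n * (n + 1) : ℝ))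
            * ((‖x‖ ^ 2) ^ m' * (‖x‖ ^ 2 * ⟪gradient C x, a⟫ - ⟪a, x⟫ * ⟪gradient C x, x⟫))) = 0 := by
    intro x hx
    have h := (dipoleTower_pair_identities hm hn hmn hA hhomA hharmA hB hhomB hharmB hC hhomC hharmC hL1 hx).2
    have h1m : ¬ Even (1 + m) := by rw [add_comm, Nat.even_add_one, not_not]; exact ⟨m', hm'⟩
    have h1n : ¬ Even (1 + n) := by rw [add_comm, Nat.even_add_one, not_not]; exact ⟨n', hn'⟩
    have hmn' : Even (m + n) := Nat.even_add.2 ⟨fun _ => ⟨n', hn'⟩, fun _ => ⟨m', hm'⟩⟩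
    rw [if_neg h1m, if_neg h1n, if_pos hmn', add_zero] at h
    have hρ : 0 < ‖x‖ ^ 2 := by positivity
    -- the brackets through `D = ⟪x, b × a⟫`
    have hAB : ‖cross a x‖ ^ 2 * ⟪x, cross (gradient A x) (gradient B x)⟫
        = (‖x‖ ^ 2 * ⟪gradient B x, a⟫ - ⟪a, x⟫ * ⟪gradient B x, x⟫) * ⟪x, cross b a⟫ := by
      rw [bracket_with_zonal (hBz x), hgA x]
    have hAC : ‖cross a x‖ ^ 2 * ⟪x, cross (gradient A x) (gradient C x)⟫
        = (‖x‖ ^ 2 * ⟪gradient C x, a⟫ - ⟪a, x⟫ * ⟪gradient C x, x⟫) * ⟪x, cross b a⟫ := by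
      rw [bracket_with_zonal (hCz x), hgA x]
    -- the radial weights
    have e1 : (‖x‖ ^ 2) ^ (-(1 : ℝ) / 2) * (‖x‖ ^ 2) ^ (-(m : ℝ) / 2)
        * ((‖x‖ ^ 2) ^ ((1 : ℝ) / 2) * (‖x‖ ^ 2) ^ ((m : ℝ) / 2) * (‖x‖ ^ 2) ^ ((n : ℝ) / 2)) = (‖x‖ ^ 2) ^ n' := by
      rw [← Real.rpow_add hρ, ← Real.rpow_add hρ, ← Real.rpow_add hρ, ← Real.rpow_add hρ, ← Real.rpow_natCast _ n']
      congr 1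
      rw [hn']; push_cast; ring
    have e2 : (‖x‖ ^ 2) ^ (-(1 : ℝ) / 2) * (‖x‖ ^ 2) ^ (-(n : ℝ) / 2)
        * ((‖x‖ ^ 2) ^ ((1 : ℝ) / 2) * (‖x‖ ^ 2) ^ ((m : ℝ) / 2) * (‖x‖ ^ 2) ^ ((n : ℝ) / 2)) = (‖x‖ ^ 2) ^ m' := by
      rw [← Real.rpow_add hρ, ← Real.rpow_add hρ, ← Real.rpow_add hρ, ← Real.rpow_add hρ, ← Real.rpow_natCast _ m']
      congr 1
      rw [hm']; push_cast; ring
    linear_combination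
      (‖cross a x‖ ^ 2 * ((‖x‖ ^ 2) ^ ((1 : ℝ) / 2) * (‖x‖ ^ 2) ^ ((m : ℝ) / 2) * (‖x‖ ^ 2) ^ ((n : ℝ) / 2))) * h
      - ((((1 * (1 + 1) : ℝ)) - (m * (m + 1) : ℝ)) * ‖cross a x‖ ^ 2 * ⟪x, cross (gradient A x) (gradient B x)⟫) * e1
      - ((((1 * (1 + 1) : ℝ)) - (n * (n + 1) : ℝ)) * ‖cross a x‖ ^ 2 * ⟪x, cross (gradient A x) (gradient C x)⟫) * e2
      - ((((1 * (1 + 1) : ℝ)) - (m * (m + 1) : ℝ)) * (‖x‖ ^ 2) ^ n') * hAB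
      - ((((1 * (1 + 1) : ℝ)) - (n * (n + 1) : ℝ)) * (‖x‖ ^ 2) ^ m') * hAC
  -- the dichotomy
  rcases evalE_mul_dichotomy hDpoly hQpoly hDQ with hD0 | hQ0
  · -- `⟪x, b × a⟫ ≡ 0`: `A` is zonal about `a`
    intro x
    rw [hgA x, ← inner_cross_right_eq]
    exact hD0 x
  · -- `M_W ≡ 0`: `W` is radial — impossible for `B ≠ 0`
    exfalso
    set W : E3 → ℝ := fun x => (((1 * (1 + 1) : ℝ)) - (m * (m + 1) : ℝ)) * (‖x‖ ^ 2) ^ n' * B x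
      + (((1 * (1 + 1) : ℝ)) - (n * (n + 1) : ℝ)) * (‖x‖ ^ 2) ^ m' * C x with hW
    have hW1 : ContDiff ℝ 1 W :=
      ((contDiff_const.mul ((contDiff_norm_sq ℝ).pow n')).mul (hB.of_le (by norm_cast))).add
        ((contDiff_const.mul ((contDiff_norm_sq ℝ).pow m')).mul (hC.of_le (by norm_cast)))
    -- the gradient of `W`
    have hgW : ∀ x : E3, gradient W x
        = ((((1 * (1 + 1) : ℝ)) - (m * (m + 1) : ℝ)) * (‖x‖ ^ 2) ^ n') • gradient B x
          + (B x * (2 * ((((1 * (1 + 1) : ℝ)) - (m * (m + 1) : ℝ)) * (n' * (‖x‖ ^ 2) ^ (n' - 1))))) • x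
          + (((((1 * (1 + 1) : ℝ)) - (n * (n + 1) : ℝ)) * (‖x‖ ^ 2) ^ m') • gradient C x
          + (C x * (2 * ((((1 * (1 + 1) : ℝ)) - (n * (n + 1) : ℝ)) * (m' * (‖x‖ ^ 2) ^ (m' - 1))))) • x) := by
      intro x
      have hg1 : HasDerivAt (fun s : ℝ => (((1 * (1 + 1) : ℝ)) - (m * (m + 1) : ℝ)) * s ^ n')
          ((((1 * (1 + 1) : ℝ)) - (m * (m + 1) : ℝ)) * (n' * (‖x‖ ^ 2) ^ (n' - 1))) (‖x‖ ^ 2) :=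
        (hasDerivAt_pow n' _).const_mul _
      have hg2 : HasDerivAt (fun s : ℝ => (((1 * (1 + 1) : ℝ)) - (n * (n + 1) : ℝ)) * s ^ m')
          ((((1 * (1 + 1) : ℝ)) - (n * (n + 1) : ℝ)) * (m' * (‖x‖ ^ 2) ^ (m' - 1))) (‖x‖ ^ 2) :=
        (hasDerivAt_pow m' _).const_mul _
      have hd1 : DifferentiableAt ℝ (fun y : E3 => (((1 * (1 + 1) : ℝ)) - (m * (m + 1) : ℝ)) * (‖y‖ ^ 2) ^ n' * B y) x :=
        ((hg1.differentiableAt.comp x (differentiableAt_id.norm_sq ℝ)).mul (hBd x))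
      have hd2 : DifferentiableAt ℝ (fun y : E3 => (((1 * (1 + 1) : ℝ)) - (n * (n + 1) : ℝ)) * (‖y‖ ^ 2) ^ m' * C y) x :=
        ((hg2.differentiableAt.comp x (differentiableAt_id.norm_sq ℝ)).mul (hCd x))
      rw [hW, OrderTwo.gradient_add' hd1 hd2, gradient_radialWeight_mul hg1 (hBd x),
        gradient_radialWeight_mul hg2 (hCd x), add_assoc]
    -- `W` is zonal about `a` with zero meridional derivative off the axis
    have hWrot : ∀ x : E3, cross a x ≠ 0 → ⟪gradient W x, cross a x⟫ = 0 := by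
      intro x _
      rw [hgW x, inner_add_left, inner_add_left, inner_add_left, real_inner_smul_left, real_inner_smul_left,
        real_inner_smul_left, real_inner_smul_left, real_inner_comm (cross a x) (gradient B x), hBz x,
        real_inner_comm (cross a x) (gradient C x), hCz x, real_inner_comm (cross a x) x, Zonal.inner_cross_self_right]
      ring
    have hWmer : ∀ x : E3, cross a x ≠ 0 → ⟪gradient W x, ‖x‖ ^ 2 • a - ⟪a, x⟫ • x⟫ = 0 := by
      intro x _
      have hVx : ⟪x, ‖x‖ ^ 2 • a - ⟪a, x⟫ • x⟫ = 0 := by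
        rw [inner_sub_right, inner_smul_right, inner_smul_right, real_inner_self_eq_norm_sq, real_inner_comm]; ring
      have hVB : ⟪gradient B x, ‖x‖ ^ 2 • a - ⟪a, x⟫ • x⟫ = ‖x‖ ^ 2 * ⟪gradient B x, a⟫ - ⟪a, x⟫ * ⟪gradient B x, x⟫ := by
        rw [inner_sub_right, inner_smul_right, inner_smul_right]
      have hVC : ⟪gradient C x, ‖x‖ ^ 2 • a - ⟪a, x⟫ • x⟫ = ‖x‖ ^ 2 * ⟪gradient C x, a⟫ - ⟪a, x⟫ * ⟪gradient C x, x⟫ := by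
        rw [inner_sub_right, inner_smul_right, inner_smul_right]
      have h := hQ0 x
      rw [hgW x, inner_add_left, inner_add_left, inner_add_left, real_inner_smul_left, real_inner_smul_left,
        real_inner_smul_left, real_inner_smul_left, hVB, hVC, hVx]
      linear_combination h
    -- hence rotation-invariant about every axis, hence constant on spheres
    have hall := rotInvariant_all_of_offAxis ha hW1 hWrot hWmer
    have hWd : Differentiable ℝ W := hW1.differentiable one_ne_zero
    -- homogeneity of `W`
    have hWhom : ∀ (c : ℝ) (y : E3), W (c • y) = c ^ (m + n) * W y := by
      intro c y
      simp only [hW, hhomB, hhomC, norm_smul, Real.norm_eq_abs, mul_pow, sq_abs, hm', hn']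
      ring
    -- radial form off the origin, in the shape of the even engine
    set e : E3 := EuclideanSpace.single 0 (1 : ℝ) with he
    have he1 : ‖e‖ = 1 := by simp [he]
    have hrad : ∀ x : E3, x ≠ 0 →
        (((1 * (1 + 1) : ℝ)) - (m * (m + 1) : ℝ)) * (B x * (‖x‖ ^ 2) ^ ((n : ℝ) / 2))
          + (((1 * (1 + 1) : ℝ)) - (n * (n + 1) : ℝ)) * (C x * (‖x‖ ^ 2) ^ ((m : ℝ) / 2))
          = W e * (‖x‖ ^ 2) ^ (((m : ℝ) + n) / 2) := by
      intro x hx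
      have hρ : 0 < ‖x‖ ^ 2 := by positivity
      have hsph : W x = W (‖x‖ • e) := sphereConst_of_rotInvariant_all hWd hall (by rw [norm_smul, norm_norm, he1, mul_one])
      rw [hWhom] at hsph
      have pn : (‖x‖ ^ 2) ^ ((n : ℝ) / 2) = (‖x‖ ^ 2) ^ n' := by
        rw [← Real.rpow_natCast _ n']; congr 1; rw [hn']; push_cast; ring
      have pm : (‖x‖ ^ 2) ^ ((m : ℝ) / 2) = (‖x‖ ^ 2) ^ m' := by
        rw [← Real.rpow_natCast _ m']; congr 1; rw [hm']; push_cast; ring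
      have pmn : (‖x‖ ^ 2) ^ (((m : ℝ) + n) / 2) = ‖x‖ ^ (m + n) := by
        rw [← Real.rpow_natCast ‖x‖ (m + n), ← Real.rpow_natCast ‖x‖ 2, ← Real.rpow_mul (norm_nonneg x)]
        congr 1; push_cast; ring
      rw [pn, pm, pmn]
      have hWx : W x = (((1 * (1 + 1) : ℝ)) - (m * (m + 1) : ℝ)) * (‖x‖ ^ 2) ^ n' * B x
          + (((1 * (1 + 1) : ℝ)) - (n * (n + 1) : ℝ)) * (‖x‖ ^ 2) ^ m' * C x := rfl
      linear_combination hsph - hWx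
    have hB00 := eq_zero_of_radial_combination hm hmn hc1m hB hhomB hharmB hC hhomC hharmC hrad
    obtain ⟨y, hy⟩ := hB0
    exact hy (hB00 y)

/-! ### Assembly -/

/-- ★★ **DIPOLE TOWERS AT ORDER ONE** (the body of `HorizonTower.DipoleTowerHorizonZonality`, binder for binder): a scale-free three-shell
tower `U_A + U_B + U_C` with `A ∈ 𝓗_1` (dipole), `B ∈ 𝓗_m`, `C ∈ 𝓗_n`, `2 ≤ m, n`, `m ≠ n`, `m, n` NOT BOTH ODD, all shells non-zero,
annihilated by the order-one horizon law `𝔏₁` off the centre, is coaxially zonal (axisymmetric without swirl about one common axis).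
Special case of the OPEN crux-idea conjecture `HorizonTowerZonality` (2); no NS statement. -/
theorem dipoleTowerHorizonZonality_of :
    ∀ (m n : ℕ) (A B C : E3 → ℝ), 2 ≤ m → 2 ≤ n → m ≠ n → (Even m ∨ Even n) →
    ContDiff ℝ (⊤ : ℕ∞) A → (∀ (c : ℝ) (y : E3), A (c • y) = c ^ 1 * A y) → (∀ y, Laplacian.laplacian A y = 0) →
    ContDiff ℝ (⊤ : ℕ∞) B → (∀ (c : ℝ) (y : E3), B (c • y) = c ^ m * B y) → (∀ y, Laplacian.laplacian B y = 0) →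
    ContDiff ℝ (⊤ : ℕ∞) C → (∀ (c : ℝ) (y : E3), C (c • y) = c ^ n * C y) → (∀ y, Laplacian.laplacian C y = 0) →
    (∃ y, A y ≠ 0) → (∃ y, B y ≠ 0) → (∃ y, C y ≠ 0) →
    (∀ x : E3, x ≠ 0 →
      horizonL1 (fun z => horizonProfile 1 A 0 z + horizonProfile m B 0 z + horizonProfile n C 0 z) 0 x = 0) →
    ∃ (a : E3) (gA gB gC : ℝ → ℝ), a ≠ 0 ∧
      (∀ y : E3, y ≠ 0 → A y = ‖y‖ ^ 1 * gA (inner ℝ a y / ‖y‖)) ∧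
      (∀ y : E3, y ≠ 0 → B y = ‖y‖ ^ m * gB (inner ℝ a y / ‖y‖)) ∧
      (∀ y : E3, y ≠ 0 → C y = ‖y‖ ^ n * gC (inner ℝ a y / ‖y‖)) := by
  intro m n A B C hm hn hmn hpar hA hhomA hharmA hB hhomB hharmB hC hhomC hharmC hA0 hB0 hC0 hL1
  -- the three shells are zonal about ONE axis, in rotational form
  obtain ⟨a, ha, hAz, hBz, hCz⟩ : ∃ a : E3, a ≠ 0 ∧ (∀ x : E3, ⟪cross a x, gradient A x⟫ = 0) ∧
      (∀ x : E3, ⟪cross a x, gradient B x⟫ = 0) ∧ (∀ x : E3, ⟪cross a x, gradient C x⟫ = 0) := by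
    rcases Nat.even_or_odd m with hme | hmo <;> rcases Nat.even_or_odd n with hne | hno
    · exact dipoleTower_zonal_of_even_even hm hn hmn hme hne hA hhomA hharmA hB hhomB hharmB hC hhomC hharmC hB0 hC0 hL1
    · exact dipoleTower_zonal_of_even_odd hm hn hmn hme hno hA hhomA hharmA hB hhomB hharmB hC hhomC hharmC hA0 hC0 hL1
    · exact dipoleTower_zonal_of_odd_even hm hn hmn hmo hne hA hhomA hharmA hB hhomB hharmB hC hhomC hharmC hA0 hB0 hL1
    · exfalso
      rcases hpar with h | h
      · exact (Nat.not_even_iff_odd.2 hmo) h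
      · exact (Nat.not_even_iff_odd.2 hno) h
  -- rotational form ⇒ functional form
  obtain ⟨gA, hgA⟩ := exists_zonalForm_of_inner_cross_gradient_eq_zero ha (hA.differentiable (by simp))
    (fun c y _ => hhomA c y) hAz
  obtain ⟨gB, hgB⟩ := exists_zonalForm_of_inner_cross_gradient_eq_zero ha (hB.differentiable (by simp))
    (fun c y _ => hhomB c y) hBz
  obtain ⟨gC, hgC⟩ := exists_zonalForm_of_inner_cross_gradient_eq_zero ha (hC.differentiable (by simp))
    (fun c y _ => hhomC c y) hCz
  exact ⟨a, gA, gB, gC, ha, hgA, hgB, hgC⟩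

end DipoleTowerOrderOne

end Summit.NavierStokesRegularity.NavierStokesRegularity.Theorems.PoloidalLiouville.HorizonTower

end
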